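import Literature.Computability.QuantumComplexity.PhaseQueryLayout
import Literature.Computability.QuantumComplexity.CWrapUniform
import Literature.Computability.QuantumComplexity.RazTalMachineUniform
import HarnessLib

/-!
# Phase-query families, V: the family is polynomial-time uniform

Fifth file of the construction (`PhaseQueryOps/Layout/State/Accept.lean`): **`family_isUniform`**.
By `QCircuitFamily.isUniform_of_descFn_mem_FP` it suffices that the description
`1ᴺ ↦ ⟨bin N, ⟨1^{anc N}, encode (bigCirc N)⟩⟩` is in `FP`. The encoding of the compiled program is
the concatenation of the `RtOp.bits` of `allOps` (`RazTalMachineUniform.flatMap_gateEnc_compileList`),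
and `allOps = pre ++ layers ++ hLayer Ly ++ post` is printed piecewise:

* the clean block by `RevClean.flatMap_opBits_cleanOps_mem_FP` (`CleanBlockDesc.lean`), at the data
  length `D(u)` and tableau length `nT(u)` written as counter expressions in the family index `u`
  (`DE`, `nTE`; the positions above the block through `CWrap.atE` at `nTE`, as in `CWrapExpr.lean`);
* the mask copies, negations, mode flips, the zero test and the last Hadamard layer by generator
  programs with one input (`GStmt.render_out_mem_FP`, gates rendered as in
  `RazTalMachineUniform.lean`: `opG`, and `agateG` over the controlled-Hadamard word);
* the `j`-dependent parts of layer `j` (the Toffoli controls `KW j` of the masked Hadamards, the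
  layer writes `xsJ (j+1)`) by generator programs with **two** inputs `N`, `j`
  (`GenProg.render_out₂_mem_FP`, input `1ᴺ 0 1ʲ`), assembled with the block description into the
  piece of layer `j` in the brick algebra and folded over `j < Ly` (`Brick.foldLoop`, as the quantum
  stage of `CWrapUniform.lean`).

(Arora–Barak 2009, §6.2 Def. 6.12 and Remark 6.7, proof of Thm. 6.15: descriptions printed with
counters; Bernstein–Vazirani 1997, §8.)

## References

* S. Arora, B. Barak, *Computational Complexity: A Modern Approach*, CUP 2009, §6.2, Remark 6.7,
  Thm. 6.15 (proof), §1.3 [AroraBarak2009].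
* E. Bernstein, U. Vazirani, *Quantum complexity theory*, SIAM J. Comput. 26 (1997), §8 [BernsteinVazirani1997].
* S. Aaronson, A. Ambainis, *Forrelation*, SIAM J. Comput. 47 (2018), §6 (p. 26) [AaronsonAmbainis2018].
-/

noncomputable section

namespace Literature.Computability.QuantumComplexity

open _root_.Computability Polynomial Complexity Complexity.Brick Plumb RevDesc RevSim RevClean Cryptography RazTalMachine Turing
open Complexity.SProg (dbl dbl_nil dbl_cons)

namespace PhaseQuery

variable (P : Params)

/-! ### The layout as counter expressions -/

section Expr

/-- `Wq(u) = u + cW`. [folklore] -/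
def WqE : GE := .add (.var .uu) (.const P.cW)
/-- `Ly(u) = u + cL`. [folklore] -/
def LyE : GE := .add (.var .uu) (.const P.cL)
/-- `D(u)`. [folklore] -/
def DE : GE := .add (.add (.add (.var .uu) (.mul (.const 3) (WqE P))) (LyE P)) (.const 4)
/-- `nT(u) = D(u) + 2u + 2`. [folklore] -/
def nTE : GE := .add (DE P) (.add (.mul (.const 2) (.var .uu)) (.const 2))
/-- `NN(nT u)`. [folklore] -/
def NNE : GE := CWrap.atE (nTE P) (.add (.var .xn) (ancNE P.M.tm P.e))
/-- `Wblk(u) = width(nT u)`. [folklore] -/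
def WblkE : GE := CWrap.atE (nTE P) (.add (.add (.var .xn) (ancNE P.M.tm P.e)) (.mul (JJE P.e P.M) (.const (A₁ P.M))))
/-- The emptiness wire of cell `j`. [folklore] -/
def eWE (jE : GE) : GE := .add (NNE P) (.add (.mul jE (.const (A₁ P.M))) (.const (eA P.M none)))
/-- Query wire `t` of copy `c`. [folklore] -/
def qWE (cE tE : GE) : GE := .add (.add (.var .uu) (.mul cE (WqE P))) tE
/-- Layer-register bit `i`. [folklore] -/
def jWE (iE : GE) : GE := .add (.add (.var .uu) (.mul (.const 3) (WqE P))) iE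
/-- Copy-code bit `i`. [folklore] -/
def cwE (i : ℕ) : GE := .add (.add (.add (.var .uu) (.mul (.const 3) (WqE P))) (LyE P)) (.const i)
/-- Mode bit `i`. [folklore] -/
def mwE (i : ℕ) : GE := .add (.add (.add (.var .uu) (.mul (.const 3) (WqE P))) (LyE P)) (.const (2 + i))
/-- Wire-mask bit `t`. [folklore] -/
def MWE (tE : GE) : GE := .add (WblkE P) tE
/-- Layer-mask bit `j`. [folklore] -/
def KWE (jE : GE) : GE := .add (.add (WblkE P) (WqE P)) jE
/-- The control ancilla. [folklore] -/
def aWE : GE := .add (.add (.add (WblkE P) (WqE P)) (LyE P)) (.const 1)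
/-- The answer flag. [folklore] -/
def oWE : GE := .add (.add (.add (WblkE P) (WqE P)) (LyE P)) (.const 2)

variable {P}
variable (env : GV → ℕ)

/-- Value of `WqE`. [folklore] -/
@[simp] theorem eval_WqE : (WqE P).eval env = Wq P (env .uu) := by simp [WqE, Wq, GExpr.eval]
/-- Value of `LyE`. [folklore] -/
@[simp] theorem eval_LyE : (LyE P).eval env = Ly P (env .uu) := by simp [LyE, Ly, GExpr.eval]
/-- Value of `DE`. [folklore] -/
@[simp] theorem eval_DE : (DE P).eval env = D P (env .uu) := by simp [DE, D, GExpr.eval]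
/-- Value of `nTE`. [folklore] -/
@[simp] theorem eval_nTE : (nTE P).eval env = nT P (env .uu) := by simp [nTE, nT, GExpr.eval]
/-- Value of `NNE`. [folklore] -/
@[simp] theorem eval_NNE : (NNE P).eval env = NN P.e P.M (nT P (env .uu)) := by
  simp only [NNE, CWrap.eval_atE, GExpr.eval, eval_ancNE, Function.update_self, eval_nTE]
/-- Value of `WblkE`. [folklore] -/
@[simp] theorem eval_WblkE : (WblkE P).eval env = Wblk P (env .uu) := by
  simp only [WblkE, CWrap.eval_atE, GExpr.eval, eval_ancNE, eval_JJE, Function.update_self, eval_nTE]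
  rfl
/-- Value of `eWE`. [folklore] -/
@[simp] theorem eval_eWE (jE : GE) : (eWE P jE).eval env = eW P (env .uu) (jE.eval env) := by
  simp only [eWE, GExpr.eval, eval_NNE]; rfl
/-- Value of `qWE`. [folklore] -/
@[simp] theorem eval_qWE (cE tE : GE) : (qWE P cE tE).eval env = qW P (env .uu) (cE.eval env) (tE.eval env) := by
  simp [qWE, qW, GExpr.eval]
/-- Value of `jWE`. [folklore] -/
@[simp] theorem eval_jWE (iE : GE) : (jWE P iE).eval env = jW P (env .uu) (iE.eval env) := by
  simp [jWE, jW, GExpr.eval]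
/-- Value of `cwE`. [folklore] -/
@[simp] theorem eval_cwE (i : ℕ) : (cwE P i).eval env = cw P (env .uu) i := by simp [cwE, cw, GExpr.eval]
/-- Value of `mwE`. [folklore] -/
@[simp] theorem eval_mwE (i : ℕ) : (mwE P i).eval env = mw P (env .uu) i := by
  simp [mwE, mw, GExpr.eval]; ring
/-- Value of `MWE`. [folklore] -/
@[simp] theorem eval_MWE (tE : GE) : (MWE P tE).eval env = MW P (env .uu) (tE.eval env) := by
  simp [MWE, MW, GExpr.eval]
/-- Value of `KWE`. [folklore] -/
@[simp] theorem eval_KWE (jE : GE) : (KWE P jE).eval env = KW P (env .uu) (jE.eval env) := by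
  simp [KWE, KW, GExpr.eval]
/-- Value of `aWE`. [folklore] -/
@[simp] theorem eval_aWE : (aWE P).eval env = aW P (env .uu) := by simp [aWE, aW, GExpr.eval]
/-- Value of `oWE`. [folklore] -/
@[simp] theorem eval_oWE : (oWE P).eval env = oW P (env .uu) := by simp [oWE, oW, GExpr.eval]

/-- `WqE` mentions only `uu`. [folklore] -/
theorem inUU_WqE : InUU (WqE P) := by intro x hx; simpa [WqE, GExpr.fv] using hx
/-- `LyE` mentions only `uu`. [folklore] -/
theorem inUU_LyE : InUU (LyE P) := by intro x hx; simpa [LyE, GExpr.fv] using hx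
/-- `DE` mentions only `uu`. [folklore] -/
theorem inUU_DE : InUU (DE P) := by
  intro x hx
  simp only [DE, GExpr.fv, List.mem_append, List.mem_cons, List.not_mem_nil, or_false, List.nil_append] at hx
  rcases hx with ((rfl | hx) | hx) 
  · rfl
  · exact inUU_WqE x hx
  · exact inUU_LyE x hx
/-- `nTE` mentions only `uu`. [folklore] -/
theorem inUU_nTE : InUU (nTE P) := by
  intro x hx
  simp only [nTE, GExpr.fv, List.mem_append, List.mem_cons, List.not_mem_nil, or_false, List.nil_append] at hx
  rcases hx with hx | rfl
  · exact inUU_DE x hx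
  · rfl

end Expr

/-! ### The block describes in polynomial time -/

section Block

/-- The suffix gadget of the block: one `NOT` at `d`, and `2n` `NOT`s from `d + 2`. [folklore] -/
theorem notsV_vg (d n : ℕ) :
    notsV d (CWrap.vg n) = [ClOp.not (d + 0)] ++ (List.range (2 * n)).map fun i => ClOp.not (d + 2 + i) := by
  rw [CWrap.vg, show ([true, false] : List Bool) = [true] ++ [false] from rfl, List.append_assoc, notsV_append, notsV_append,
    show ([true] : List Bool) = List.replicate 1 true from rfl, notsV_replicate_true, notsV_singleton_false,
    notsV_replicate_true]
  simp

/-- **The block describes in polynomial time**: `1ᴺ ↦ (blkC P N).flatMap opBits ∈ FP`.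
[cite: AroraBarak2009, §6.2 Def. 6.12 and Remark 6.7 (descriptions printed in polynomial time)] -/
theorem blk_desc_mem_FP : (fun z : List Bool => (blkC P z.length).flatMap opBits) ∈ FP := by
  have h := flatMap_opBits_cleanOps_mem_FP (e := P.e) (M := P.M) (DE P) (nTE P)
    [(DE P, .const 1), (.add (DE P) (.const 2), .mul (.const 2) (.var .uu))] inUU_nTE
    (fun p hp => by
      simp only [List.mem_cons, List.not_mem_nil, or_false] at hp
      rcases hp with rfl | rfl
      · exact inUU_DE
      · intro x hx
        simp only [GExpr.fv, List.mem_append, List.not_mem_nil, or_false] at hx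
        exact inUU_DE x hx)
    CWrap.vg (fun u => by
      rw [eval_DE]
      simp only [envU, GenProg.initEnv_self, List.flatMap_cons, List.flatMap_nil, List.append_nil, GExpr.eval, eval_DE]
      rw [notsV_vg]
      simp)
    (fun u => by simp [nT, GenProg.initEnv])
  refine (congrArg (· ∈ FP) (funext fun z => ?_)).mpr h
  simp [blkC, GenProg.initEnv]

end Block

/-! ### Generator programs for `RtOp` templates -/

section Gen

/-- A Hadamard gate. [folklore] -/
def hadG (a : GE) : GS := agateG ⟨.H, [a]⟩

/-- The stream of `hadG`. [folklore] -/
@[simp] theorem out_hadG (a : GE) (env : GV → ℕ) : (hadG a).out env = (RtOp.had (a.eval env)).toks := by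
  simp [hadG, RtOp.toks, AGate.toks, AGate.map, symCode, symArity]

/-- A controlled-Hadamard word. [folklore] -/
def chadG (c a : GE) : GS := seqs ((chadAGates c a).map agateG)

/-- The stream of `chadG`. [folklore] -/
@[simp] theorem out_chadG (c a : GE) (env : GV → ℕ) :
    (chadG c a).out env = (RtOp.chad (c.eval env) (a.eval env)).toks := by
  simp [chadG, RtOp.toks, chadAGates_map, List.flatMap_map]

/-- One `RtOp` template (oracle queries print nothing; the program has none). [folklore] -/
def rtG : RtOp GE → GS
  | .cl op => opG op
  | .had a => hadG a
  | .chad c a => chadG c a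
  | .oracle _ _ => .emit []

/-- A program of `RtOp` templates. [folklore] -/
def rtsG (ops : List (RtOp GE)) : GS := seqs (ops.map rtG)

/-- A template program without oracle queries. [folklore] -/
def NoOracle (ops : List (RtOp GE)) : Prop := ∀ op ∈ ops, ∀ qs t, op ≠ RtOp.oracle qs t

/-- The stream of a template is the token stream of its instance. [folklore] -/
theorem out_rtG (env : GV → ℕ) (op : RtOp GE) (h : ∀ qs t, op ≠ RtOp.oracle qs t) :
    (rtG op).out env = (op.map (GExpr.eval env)).toks := by
  cases op with
  | cl op => simp [rtG, RtOp.map, RtOp.toks]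
  | had a => simp [rtG, RtOp.map]
  | chad c a => simp [rtG, RtOp.map]
  | oracle qs t => exact absurd rfl (h qs t)

/-- **The stream of a template program is the token stream of its instance.** [folklore] -/
theorem out_rtsG (env : GV → ℕ) (ops : List (RtOp GE)) (h : NoOracle ops) :
    (rtsG ops).out env = (ops.map (RtOp.map (GExpr.eval env))).flatMap RtOp.toks := by
  rw [rtsG, out_seqs, List.flatMap_map, List.flatMap_map]
  exact List.flatMap_congr fun op hop => out_rtG env op (h op hop)

/-- Loop variables of an abstract gate: only the tick counter. [folklore] -/
theorem lv_agateG {Q : GV → Prop} (hQ : Q .ii) (g : AGate GE) : LV Q (agateG g) := by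
  intro x hx
  simp only [agateG, GStmt.loopVars, loopVars_seqs, List.flatMap_map, List.mem_flatMap, List.nil_append, List.append_nil,
    loopVars_wireG, List.mem_singleton] at hx
  obtain ⟨_, _, rfl⟩ := hx
  exact hQ

/-- Loop variables of a template: only the tick counter. [folklore] -/
theorem lv_rtG {Q : GV → Prop} (hQ : Q .ii) (op : RtOp GE) : LV Q (rtG op) := by
  cases op with
  | cl op =>
    change LV Q (opG op)
    exact lv_seqs_map fun g => lv_agateG hQ g
  | had a => exact lv_agateG hQ _
  | chad c a => exact lv_seqs_map fun g => lv_agateG hQ g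
  | oracle qs t => exact lv_emit _

/-- Loop variables of a template program. [folklore] -/
theorem lv_rtsG {Q : GV → Prop} (hQ : Q .ii) (ops : List (RtOp GE)) : LV Q (rtsG ops) := lv_seqs_map fun op => lv_rtG hQ op

/-- An abstract gate does not reuse loop variables. [folklore] -/
theorem noReuse_agateG (g : AGate GE) : (agateG g).noReuse = true := by
  simp only [agateG, GStmt.noReuse, Bool.true_and, Bool.and_true]
  exact noReuse_seqs_map fun w => rfl

/-- A template does not reuse loop variables. [folklore] -/
theorem noReuse_rtG (op : RtOp GE) : (rtG op).noReuse = true := by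
  cases op with
  | cl op => exact noReuse_seqs_map fun g => noReuse_agateG g
  | had a => exact noReuse_agateG _
  | chad c a => exact noReuse_seqs_map fun g => noReuse_agateG g
  | oracle qs t => rfl

/-- A template program does not reuse loop variables. [folklore] -/
theorem noReuse_rtsG (ops : List (RtOp GE)) : (rtsG ops).noReuse = true := noReuse_seqs_map fun op => noReuse_rtG op

/-- A loop over a template program reuses nothing if its index is not the tick counter. [folklore] -/
theorem noReuse_loop_rtsG {i : GV} (hi : i ≠ .ii) (c : GE) (ops : List (RtOp GE)) :
    (GStmt.loop i c (rtsG ops)).noReuse = true :=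
  noReuse_loop_of (lv_rtsG (Q := (· ≠ i)) (fun h => hi h.symm) ops) (noReuse_rtsG ops)

end Gen

/-! ### Templates of the program parts and their generators -/

section Templates

/-- The Toffoli of the masked Hadamard, as a template. [folklore] -/
def tofT (jE tE : GE) : ClOp GE := ClOp.toffoli (KWE P jE) (MWE P tE) (aWE P)

/-- The masked controlled Hadamard, as a template. [folklore] -/
def hGadT (jE cE tE : GE) : List (RtOp GE) :=
  [RtOp.cl (tofT P jE tE), RtOp.chad (aWE P) (qWE P cE tE), RtOp.cl (tofT P jE tE)]

/-- Instance of the gadget template. [folklore] -/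
theorem hGadT_map (jE cE tE : GE) (env : GV → ℕ) :
    (hGadT P jE cE tE).map (RtOp.map (GExpr.eval env)) = hGad P (env .uu) (jE.eval env) (cE.eval env) (tE.eval env) := by
  simp [hGadT, hGad, tofT, RtOp.map, ClOp.map]

/-- The gadget template has no oracle query. [folklore] -/
theorem noOracle_hGadT (jE cE tE : GE) : NoOracle (hGadT P jE cE tE) := by
  intro op hop qs t h; subst h; simp [hGadT] at hop

/-- **The generator of Hadamard layer `j`** (copies unrolled, a loop over the wires). [folklore] -/
def hLayerG (jE : GE) : GS :=
  seqs [GStmt.loop .jj (WqE P) (rtsG (hGadT P jE (.const 0) (.var .jj))),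
    GStmt.loop .jj (WqE P) (rtsG (hGadT P jE (.const 1) (.var .jj))),
    GStmt.loop .jj (WqE P) (rtsG (hGadT P jE (.const 2) (.var .jj)))]

/-- The Hadamard-layer generator prints the layer. [folklore] -/
theorem out_hLayerG (jE : GE) (hjE : GV.jj ∉ jE.fv) (env : GV → ℕ) :
    (hLayerG P jE).out env = (hLayer P (env .uu) (jE.eval env)).flatMap RtOp.toks := by
  have hrow : ∀ c : ℕ, (GStmt.loop .jj (WqE P) (rtsG (hGadT P jE (.const c) (.var .jj)))).out env =
      ((List.range (Wq P (env .uu))).flatMap fun t => hGad P (env .uu) (jE.eval env) c t).flatMap RtOp.toks := by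
    intro c
    simp only [GStmt.out, eval_WqE, List.flatMap_assoc]
    refine List.flatMap_congr fun t _ => ?_
    rw [out_rtsG _ _ (noOracle_hGadT P _ _ _), hGadT_map]
    rw [GExpr.eval_update_of_not_mem_fv env GV.jj t jE hjE]
    simp [GExpr.eval]
  rw [hLayerG, out_seqs]
  simp only [List.flatMap_cons, List.flatMap_nil, List.append_nil, hrow, hLayer]
  simp [List.flatMap_assoc, List.range_succ]

/-- Hygiene of the Hadamard-layer generator. [folklore] -/
theorem lv_hLayerG {Q : GV → Prop} (hii : Q .ii) (hjj : Q .jj) (jE : GE) : LV Q (hLayerG P jE) :=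
  lv_seqs fun s hs => by
    simp only [List.mem_cons, List.not_mem_nil, or_false] at hs
    rcases hs with rfl | rfl | rfl <;> exact lv_loop hjj (lv_rtsG hii _)

/-- Non-reuse of the Hadamard-layer generator. [folklore] -/
theorem noReuse_hLayerG (jE : GE) : (hLayerG P jE).noReuse = true :=
  noReuse_seqs _ fun s hs => by
    simp only [List.mem_cons, List.not_mem_nil, or_false] at hs
    rcases hs with rfl | rfl | rfl <;> exact noReuse_loop_rtsG (by decide) _ _

/-- **The generator of the layer write `xsJ j`.** [folklore] -/
def xsJG (jE : GE) : GS := GStmt.loop .tt jE (opsG [ClOp.not (jWE P (.var .tt))])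

/-- The layer-write generator prints `xsJ`. [folklore] -/
theorem out_xsJG (jE : GE) (env : GV → ℕ) :
    (xsJG P jE).out env = (xsJ P (env .uu) (jE.eval env)).flatMap opToks := by
  simp [xsJG, GStmt.out, xsJ, List.flatMap_map, ClOp.map, GExpr.eval]

/-- The copy-code writes as templates. [folklore] -/
def xsCT (c : ℕ) : List (ClOp GE) :=
  if c = 1 then [ClOp.not (cwE P 0)] else if c = 2 then [ClOp.not (cwE P 1)] else []

/-- Instance of the copy-code template. [folklore] -/
theorem xsCT_map (c : ℕ) (env : GV → ℕ) : (xsCT P c).map (ClOp.map (GExpr.eval env)) = xsC P (env .uu) c := by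
  unfold xsCT xsC; split_ifs <;> simp [ClOp.map]

/-- **The generator of the classical opening of the phase macro** (layer write, copy code, mode).
[folklore] -/
def openPreG (jE : GE) (c : ℕ) : GS := .seq (xsJG P jE) (opsG (xsCT P c ++ [ClOp.not (mwE P 1)]))

/-- The opening generator prints `xsJ j ++ xsC c ++ [NOT mw₁]`. [folklore] -/
theorem out_openPreG (jE : GE) (c : ℕ) (env : GV → ℕ) :
    (openPreG P jE c).out env =
      (xsJ P (env .uu) (jE.eval env) ++ xsC P (env .uu) c ++ [ClOp.not (mw P (env .uu) 1)]).flatMap opToks := by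
  rw [openPreG, GStmt.out, out_xsJG, out_opsG, List.map_append, xsCT_map]
  simp [List.flatMap_append, ClOp.map]

/-- **The generator of the classical closing of the phase macro.** [folklore] -/
def closePostG (jE : GE) (c : ℕ) : GS := .seq (opsG ([ClOp.not (mwE P 1)] ++ xsCT P c)) (xsJG P jE)

/-- The closing generator prints `[NOT mw₁] ++ xsC c ++ xsJ j`. [folklore] -/
theorem out_closePostG (jE : GE) (c : ℕ) (env : GV → ℕ) :
    (closePostG P jE c).out env =
      ([ClOp.not (mw P (env .uu) 1)] ++ xsC P (env .uu) c ++ xsJ P (env .uu) (jE.eval env)).flatMap opToks := by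
  rw [closePostG, GStmt.out, out_xsJG, out_opsG, List.map_append, xsCT_map]
  simp [List.flatMap_append, ClOp.map]

/-- Hygiene of the opening and closing generators. [folklore] -/
theorem lv_openPreG {Q : GV → Prop} (hii : Q .ii) (htt : Q .tt) (jE : GE) (c : ℕ) :
    LV Q (openPreG P jE c) ∧ LV Q (closePostG P jE c) :=
  ⟨lv_seq (lv_loop htt (lv_opsG hii _)) (lv_opsG hii _), lv_seq (lv_opsG hii _) (lv_loop htt (lv_opsG hii _))⟩

/-- Non-reuse of the opening and closing generators. [folklore] -/
theorem noReuse_openPreG (jE : GE) (c : ℕ) : (openPreG P jE c).noReuse = true ∧ (closePostG P jE c).noReuse = true :=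
  ⟨noReuse_seq_of (noReuse_loop_of (lv_opsG (P := (· ≠ GV.tt)) (by decide) _) (noReuse_opsG _)) (noReuse_opsG _),
    noReuse_seq_of (noReuse_opsG _) (noReuse_loop_of (lv_opsG (P := (· ≠ GV.tt)) (by decide) _) (noReuse_opsG _))⟩

/-- The `Z` gadget of the phase macro, as a template program. [folklore] -/
def zT : List (RtOp GE) := zOps (eWE P (.const 0))

/-- **The generator of the `Z` gadget.** [folklore] -/
def zG : GS := rtsG (zT P)

/-- The `Z` generator prints `zOps (eW 0)`. [folklore] -/
theorem out_zG (env : GV → ℕ) : (zG P).out env = (zOps (eW P (env .uu) 0)).flatMap RtOp.toks := by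
  rw [zG, out_rtsG _ _ (fun op hop qs t h => by subst h; simp [zT, zOps] at hop), zT, zOps_map]
  simp [GExpr.eval]

end Templates

/-! ### The generators of the mask stage, the zero test, and the layer pieces -/

section Parts

/-- Mask stage, part 1: the wire-mask copies. [folklore] -/
def preG1 : GS := GStmt.loop .jj (WqE P) (opsG [ClOp.cnot (eWE P (.var .jj)) (MWE P (.var .jj))])
/-- Mask stage, part 2: mode `K`. [folklore] -/
def preG2 : GS := opsG [ClOp.not (mwE P 0)]
/-- Mask stage, part 3: the layer-mask copies. [folklore] -/
def preG3 : GS := GStmt.loop .jj (.add (LyE P) (.const 1)) (opsG [ClOp.cnot (eWE P (.var .jj)) (KWE P (.var .jj))])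
/-- Mask stage, part 4: unmode, negate the masks. [folklore] -/
def preG4 : GS :=
  seqs [opsG [ClOp.not (mwE P 0)], GStmt.loop .jj (WqE P) (opsG [ClOp.not (MWE P (.var .jj))]),
    GStmt.loop .jj (.add (LyE P) (.const 1)) (opsG [ClOp.not (KWE P (.var .jj))])]

/-- The streams of the mask-stage parts. [folklore] -/
theorem out_preG (u : ℕ) :
    (preG1 P).out (envU u) = (copyOps (pairsM P u)).flatMap opToks ∧
    (preG2 P).out (envU u) = [ClOp.not (mw P u 0)].flatMap opToks ∧
    (preG3 P).out (envU u) = (copyOps (pairsK P u)).flatMap opToks ∧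
    (preG4 P).out (envU u) = ([ClOp.not (mw P u 0)] ++ notsM P u ++ notsK P u).flatMap opToks := by
  refine ⟨?_, ?_, ?_, ?_⟩
  · simp [preG1, GStmt.out, copyOps, pairsM, List.flatMap_map, ClOp.map, GExpr.eval, envU]
  · simp [preG2, ClOp.map, envU]
  · simp [preG3, GStmt.out, copyOps, pairsK, List.flatMap_map, ClOp.map, GExpr.eval, envU]
  · simp [preG4, GStmt.out, notsM, notsK, List.flatMap_map, List.flatMap_append, ClOp.map, GExpr.eval, envU]

/-- Zero test, part 1: the last Hadamard layer and mode `Z`. [folklore] -/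
def finG1 : GS := .seq (hLayerG P (LyE P)) (opsG [ClOp.not (mwE P 0), ClOp.not (mwE P 1)])
/-- Zero test, part 2: flag the answer. [folklore] -/
def finG2 : GS := opsG [ClOp.cnot (eWE P (.const 0)) (oWE P), ClOp.not (oWE P)]
/-- Zero test, part 3: unmode and swap. [folklore] -/
def finG3 : GS :=
  opsG [ClOp.not (mwE P 0), ClOp.not (mwE P 1), ClOp.cnot (oWE P) (.const 0), ClOp.cnot (.const 0) (oWE P),
    ClOp.cnot (oWE P) (.const 0)]

/-- The streams of the zero-test parts. [folklore] -/
theorem out_finG (u : ℕ) :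
    (finG1 P).out (envU u) = (hLayer P u (Ly P u)).flatMap RtOp.toks ++ [ClOp.not (mw P u 0), ClOp.not (mw P u 1)].flatMap opToks ∧
    (finG2 P).out (envU u) = [ClOp.cnot (eW P u 0) (oW P u), ClOp.not (oW P u)].flatMap opToks ∧
    (finG3 P).out (envU u) = [ClOp.not (mw P u 0), ClOp.not (mw P u 1), ClOp.cnot (oW P u) 0, ClOp.cnot 0 (oW P u),
      ClOp.cnot (oW P u) 0].flatMap opToks := by
  refine ⟨?_, ?_, ?_⟩
  · rw [finG1, GStmt.out, out_hLayerG P (LyE P) (by simp [LyE, GExpr.fv]), out_opsG]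
    simp [ClOp.map, envU]
  · simp [finG2, ClOp.map, GExpr.eval, envU]
  · simp [finG3, ClOp.map, GExpr.eval, envU]

/-- The layer index `j` as the second input. [folklore] -/
def jv : GE := .var .xn
/-- `j + 1`. [folklore] -/
def jv1 : GE := .add (.var .xn) (.const 1)

/-- Layer piece, part a: Hadamard layer `j` and the opening of the first phase macro. [folklore] -/
def GaG : GS := .seq (hLayerG P jv) (openPreG P jv1 0)
/-- Layer piece, part b: closing of the first, opening of the second phase macro. [folklore] -/
def GbG : GS := .seq (closePostG P jv1 0) (openPreG P jv1 1)
/-- Layer piece, part c: closing of the second, opening of the third phase macro. [folklore] -/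
def GcG : GS := .seq (closePostG P jv1 1) (openPreG P jv1 2)
/-- Layer piece, part d: closing of the third phase macro. [folklore] -/
def GdG : GS := closePostG P jv1 2

/-- The two-input environment. [folklore] -/
abbrev env₂ (u j : ℕ) : GV → ℕ := GenProg.initEnv₂ GV.uu GV.xn u j

/-- Values of the inputs in the two-input environment. [folklore] -/
@[simp] theorem env₂_uu (u j : ℕ) : env₂ u j .uu = u := by simp [env₂, GenProg.initEnv₂]
/-- Values of the inputs in the two-input environment. [folklore] -/
@[simp] theorem env₂_xn (u j : ℕ) : env₂ u j .xn = j := by simp [env₂, GenProg.initEnv₂]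

/-- The opening operations of the phase macro. [folklore] -/
def openOps (u j c : ℕ) : List (ClOp ℕ) := xsJ P u j ++ xsC P u c ++ [ClOp.not (mw P u 1)]
/-- The closing operations of the phase macro. [folklore] -/
def closeOps (u j c : ℕ) : List (ClOp ℕ) := [ClOp.not (mw P u 1)] ++ xsC P u c ++ xsJ P u j

/-- `pOpen = openOps ++ blkC`, `pClose = blkC ++ closeOps`. [folklore] -/
theorem pOpen_eq (u j c : ℕ) : pOpen P u j c = openOps P u j c ++ blkC P u ∧ pClose P u j c = blkC P u ++ closeOps P u j c := by
  simp [pOpen, pClose, openOps, closeOps]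

/-- The streams of the layer-piece parts. [folklore] -/
theorem out_GG (u j : ℕ) :
    (GaG P).out (env₂ u j) = (hLayer P u j).flatMap RtOp.toks ++ (openOps P u (j + 1) 0).flatMap opToks ∧
    (GbG P).out (env₂ u j) = (closeOps P u (j + 1) 0).flatMap opToks ++ (openOps P u (j + 1) 1).flatMap opToks ∧
    (GcG P).out (env₂ u j) = (closeOps P u (j + 1) 1).flatMap opToks ++ (openOps P u (j + 1) 2).flatMap opToks ∧
    (GdG P).out (env₂ u j) = (closeOps P u (j + 1) 2).flatMap opToks := by
  have h1 : GV.jj ∉ (jv).fv := by simp [jv, GExpr.fv]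
  refine ⟨?_, ?_, ?_, ?_⟩
  · rw [GaG, GStmt.out, out_hLayerG P jv h1, out_openPreG]; simp [jv, jv1, GExpr.eval, openOps]
  · rw [GbG, GStmt.out, out_closePostG, out_openPreG]; simp [jv1, GExpr.eval, openOps, closeOps]
  · rw [GcG, GStmt.out, out_closePostG, out_openPreG]; simp [jv1, GExpr.eval, openOps, closeOps]
  · rw [GdG, out_closePostG]; simp [jv1, GExpr.eval, closeOps]

/-! #### Hygiene -/

/-- The input `uu` and the second input `xn` are not loop variables of the parts, which reuse no
loop variable. [folklore] -/
theorem hygiene :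
    (∀ s ∈ [preG1 P, preG2 P, preG3 P, preG4 P, finG1 P, finG2 P, finG3 P, zG P, GaG P, GbG P, GcG P, GdG P],
      GV.uu ∉ s.loopVars ∧ GV.xn ∉ s.loopVars ∧ s.noReuse = true) := by
  have key : ∀ s : GS, LV (fun x => x = .ii ∨ x = .jj ∨ x = .tt) s → s.noReuse = true →
      GV.uu ∉ s.loopVars ∧ GV.xn ∉ s.loopVars ∧ s.noReuse = true := fun s h hn =>
    ⟨fun hu => by rcases h _ hu with h | h | h <;> exact absurd h (by decide),
      fun hu => by rcases h _ hu with h | h | h <;> exact absurd h (by decide), hn⟩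
  have hii : (GV.ii = .ii ∨ GV.ii = .jj ∨ GV.ii = .tt) := Or.inl rfl
  have hjj : (GV.jj = .ii ∨ GV.jj = .jj ∨ GV.jj = .tt) := Or.inr (Or.inl rfl)
  have htt : (GV.tt = .ii ∨ GV.tt = .jj ∨ GV.tt = .tt) := Or.inr (Or.inr rfl)
  have hop := fun (jE : GE) (c : ℕ) => lv_openPreG P (Q := fun x => x = .ii ∨ x = .jj ∨ x = .tt) hii htt jE c
  have hnr := fun jE c => noReuse_openPreG P jE c
  have hloop : ∀ (c : GE) (ops : List (ClOp GE)), (GStmt.loop GV.jj c (opsG ops)).noReuse = true :=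
    fun c ops => noReuse_loop_of (lv_opsG (P := (· ≠ GV.jj)) (by decide) _) (noReuse_opsG _)
  intro s hs
  simp only [List.mem_cons, List.not_mem_nil, or_false] at hs
  rcases hs with rfl | rfl | rfl | rfl | rfl | rfl | rfl | rfl | rfl | rfl | rfl | rfl
  · exact key _ (lv_loop hjj (lv_opsG hii _)) (hloop _ _)
  · exact key _ (lv_opsG hii _) (noReuse_opsG _)
  · exact key _ (lv_loop hjj (lv_opsG hii _)) (hloop _ _)
  · exact key _ (lv_seqs fun s hs => by
      simp only [List.mem_cons, List.not_mem_nil, or_false] at hs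
      rcases hs with rfl | rfl | rfl
      · exact lv_opsG hii _
      · exact lv_loop hjj (lv_opsG hii _)
      · exact lv_loop hjj (lv_opsG hii _))
      (noReuse_seqs _ fun s hs => by
        simp only [List.mem_cons, List.not_mem_nil, or_false] at hs
        rcases hs with rfl | rfl | rfl
        · exact noReuse_opsG _
        · exact hloop _ _
        · exact hloop _ _)
  · exact key _ (lv_seq (lv_hLayerG P hii hjj _) (lv_opsG hii _)) (noReuse_seq_of (noReuse_hLayerG P _) (noReuse_opsG _))
  · exact key _ (lv_opsG hii _) (noReuse_opsG _)
  · exact key _ (lv_opsG hii _) (noReuse_opsG _)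
  · exact key _ (lv_rtsG hii _) (noReuse_rtsG _)
  · exact key _ (lv_seq (lv_hLayerG P hii hjj _) (hop _ _).1) (noReuse_seq_of (noReuse_hLayerG P _) (hnr _ _).1)
  · exact key _ (lv_seq (hop _ _).2 (hop _ _).1) (noReuse_seq_of (hnr _ _).2 (hnr _ _).1)
  · exact key _ (lv_seq (hop _ _).2 (hop _ _).1) (noReuse_seq_of (hnr _ _).2 (hnr _ _).1)
  · exact key _ (hop _ _).2 (hnr _ _).2

end Parts

/-! ### The parts as polynomial-time string functions -/

section FPParts

/-- A one-input generated description: render the stream at `uu = |z|`. [folklore] -/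
def g1F (s : GS) (z : List Bool) : List Bool := Tok.render 0 (s.out (envU z.length))

/-- One-input generated descriptions are polynomial time. [cite: AroraBarak2009, §6.2 (proof of Thm. 6.15)] -/
theorem g1F_mem_FP (s : GS) (h : GV.uu ∉ s.loopVars) (hs : s.noReuse = true) : g1F s ∈ FP :=
  GStmt.render_out_mem_FP s .uu h hs

/-- A two-input generated description: render the stream at the parsed environment of `1ᵘ 0 w`
(`uu = u`, `xn = |w|`). [folklore] -/
def g2F (s : GS) (w : List Bool) : List Bool := Tok.render 0 (s.out (GenProg.parseEnv .uu .xn (fun _ => 0) w))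

/-- Two-input generated descriptions are polynomial time. [cite: AroraBarak2009, §6.2 (proof of Thm. 6.15)] -/
theorem g2F_mem_FP (s : GS) (h0 : GV.uu ∉ s.loopVars) (h1 : GV.xn ∉ s.loopVars) (hs : s.noReuse = true) : g2F s ∈ FP :=
  GStmt.render_out₂_mem_FP s .uu .xn h0 h1 hs

/-- The two-input function on a formatted input `1ᵘ 0 1ʲ`. [folklore] -/
theorem g2F_fmt (s : GS) (u j : ℕ) : g2F s (List.replicate u true ++ false :: ones j) = Tok.render 0 (s.out (env₂ u j)) := by
  rw [g2F, GenProg.parseEnv_replicate (by decide) u (ones j)]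
  simp [ones]

/-- Program tokens render to program bits. [folklore] -/
theorem render_rtoks_nil (ops : List (RtOp ℕ)) : Tok.render 0 (ops.flatMap RtOp.toks) = ops.flatMap RtOp.bits := by
  have h := render_flatMap_rtoks ops []
  rwa [List.append_nil, Tok.render_nil, List.append_nil] at h

/-- Mixed streams render to bits. [folklore] -/
theorem render_rtoks_opToks (ops : List (RtOp ℕ)) (ops' : List (ClOp ℕ)) :
    Tok.render 0 (ops.flatMap RtOp.toks ++ ops'.flatMap opToks) = ops.flatMap RtOp.bits ++ ops'.flatMap opBits := by
  rw [render_flatMap_rtoks, render_flatMap_opToks_nil]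

/-- The bits of classical operations as `RtOp`s. [folklore] -/
theorem flatMap_bits_map_cl (ops : List (ClOp ℕ)) : (ops.map RtOp.cl).flatMap RtOp.bits = ops.flatMap opBits := by
  rw [List.flatMap_map]; rfl

/-- **The block description function.** [folklore] -/
def BF (z : List Bool) : List Bool := (blkC P z.length).flatMap opBits

/-- **The description of the mask stage.** [folklore] -/
def preF (z : List Bool) : List Bool :=
  BF P z ++ (g1F (preG1 P) z ++ (BF P z ++ (g1F (preG2 P) z ++ (BF P z ++ (g1F (preG3 P) z ++ (BF P z ++ g1F (preG4 P) z))))))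

/-- `preF ∈ FP`. [folklore] -/
theorem preF_mem_FP : preF P ∈ FP := by
  have hB := blk_desc_mem_FP P
  have hy := hygiene P
  have h1 := g1F_mem_FP (preG1 P) (hy _ (by simp)).1 (hy _ (by simp)).2.2
  have h2 := g1F_mem_FP (preG2 P) (hy _ (by simp)).1 (hy _ (by simp)).2.2
  have h3 := g1F_mem_FP (preG3 P) (hy _ (by simp)).1 (hy _ (by simp)).2.2
  have h4 := g1F_mem_FP (preG4 P) (hy _ (by simp)).1 (hy _ (by simp)).2.2
  have h := append_mem_FP hB (append_mem_FP h1 (append_mem_FP hB (append_mem_FP h2 (append_mem_FP hB (append_mem_FP h3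
    (append_mem_FP hB h4))))))
  refine (congrArg (· ∈ FP) (funext fun w => ?_)).mpr h
  rfl

/-- **`preF` computes the description of the mask stage.** [folklore] -/
theorem preF_apply (z : List Bool) : preF P z = (pre P z.length).flatMap RtOp.bits := by
  obtain ⟨e1, e2, e3, e4⟩ := out_preG P z.length
  rw [pre, flatMap_bits_map_cl, preC]
  simp only [preF, BF, g1F, e1, e2, e3, e4, render_flatMap_opToks_nil]
  simp only [List.flatMap_append, List.append_assoc]

/-- **The description of the last Hadamard layer and the zero test.** [folklore] -/
def finF (z : List Bool) : List Bool :=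
  g1F (finG1 P) z ++ (BF P z ++ (g1F (finG2 P) z ++ (BF P z ++ g1F (finG3 P) z)))

/-- `finF ∈ FP`. [folklore] -/
theorem finF_mem_FP : finF P ∈ FP := by
  have hB := blk_desc_mem_FP P
  have hy := hygiene P
  have h1 := g1F_mem_FP (finG1 P) (hy _ (by simp)).1 (hy _ (by simp)).2.2
  have h2 := g1F_mem_FP (finG2 P) (hy _ (by simp)).1 (hy _ (by simp)).2.2
  have h3 := g1F_mem_FP (finG3 P) (hy _ (by simp)).1 (hy _ (by simp)).2.2
  have h := append_mem_FP h1 (append_mem_FP hB (append_mem_FP h2 (append_mem_FP hB h3)))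
  refine (congrArg (· ∈ FP) (funext fun w => ?_)).mpr h
  rfl

/-- **`finF` computes the description of the last Hadamard layer and the zero test.** [folklore] -/
theorem finF_apply (z : List Bool) : finF P z = (hLayer P z.length (Ly P z.length) ++ post P z.length).flatMap RtOp.bits := by
  obtain ⟨e1, e2, e3⟩ := out_finG P z.length
  rw [List.flatMap_append, post, flatMap_bits_map_cl, postC]
  simp only [finF, BF, g1F, e1, e2, e3, render_rtoks_opToks, render_flatMap_opToks_nil]
  simp only [List.flatMap_append, List.append_assoc, List.flatMap_cons, List.flatMap_nil, List.append_nil]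

/-- The context `z` of the fold record `⟨⟨z, ruler⟩, 1ʲ⟩`. [folklore] -/
def zOfF : List Bool → List Bool := fstF ∘ fstF

/-- The formatted input `1^{|z|} 0 1ʲ` of the two-input generators, from `⟨⟨z, ruler⟩, 1ʲ⟩`. [folklore] -/
def fmt2 (w : List Bool) : List Bool := onesFn (zOfF w) ++ ([false] ++ sndF w)

/-- `fmt2 ∈ FP`. [folklore] -/
theorem fmt2_mem_FP : fmt2 ∈ FP :=
  append_mem_FP (comp_mem_FP onesFn_mem_FP (comp_mem_FP fstF_mem_FP fstF_mem_FP))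
    (append_mem_FP (const_mem_FP [false]) sndF_mem_FP)

/-- Value of `fmt2` on a record. [folklore] -/
theorem fmt2_apply (z r : List Bool) (j : ℕ) :
    fmt2 (boolPair (boolPair z r) (ones j)) = List.replicate z.length true ++ false :: ones j := by
  simp [fmt2, zOfF, onesFn, RevDesc.unaryEncodeNat_eq_replicate]

/-- Value of `zOfF` on a record. [folklore] -/
@[simp] theorem zOfF_apply (z r y : List Bool) : zOfF (boolPair (boolPair z r) y) = z := by simp [zOfF]

/-- The block component of the piece (a function of the context `z`). [folklore] -/
def BFz : List Bool → List Bool := (fun z : List Bool => (blkC P z.length).flatMap opBits) ∘ zOfF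
/-- The `Z` component of the piece. [folklore] -/
def ZFz : List Bool → List Bool := g1F (zG P) ∘ zOfF
/-- The two-input components of the piece. [folklore] -/
def GaF : List Bool → List Bool := g2F (GaG P) ∘ fmt2
/-- The two-input components of the piece. [folklore] -/
def GbF : List Bool → List Bool := g2F (GbG P) ∘ fmt2
/-- The two-input components of the piece. [folklore] -/
def GcF : List Bool → List Bool := g2F (GcG P) ∘ fmt2
/-- The two-input components of the piece. [folklore] -/
def GdF : List Bool → List Bool := g2F (GdG P) ∘ fmt2

/-- **The piece of layer `j`**: Hadamard layer `j` and the three phase macros of layer `j + 1`,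
from the record `⟨⟨z, ruler⟩, 1ʲ⟩`. [folklore] -/
def pieceF (w : List Bool) : List Bool :=
  GaF P w ++ (BFz P w ++ (ZFz P w ++ (BFz P w ++ (GbF P w ++ (BFz P w ++ (ZFz P w ++ (BFz P w ++
    (GcF P w ++ (BFz P w ++ (ZFz P w ++ (BFz P w ++ GdF P w)))))))))))

/-- The two-input components of the piece are polynomial time. [folklore] -/
theorem g2F_parts_mem_FP : g2F (GaG P) ∈ FP ∧ g2F (GbG P) ∈ FP ∧ g2F (GcG P) ∈ FP ∧ g2F (GdG P) ∈ FP := by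
  have hy := hygiene P
  exact ⟨g2F_mem_FP _ (hy _ (by simp)).1 (hy _ (by simp)).2.1 (hy _ (by simp)).2.2,
    g2F_mem_FP _ (hy _ (by simp)).1 (hy _ (by simp)).2.1 (hy _ (by simp)).2.2,
    g2F_mem_FP _ (hy _ (by simp)).1 (hy _ (by simp)).2.1 (hy _ (by simp)).2.2,
    g2F_mem_FP _ (hy _ (by simp)).1 (hy _ (by simp)).2.1 (hy _ (by simp)).2.2⟩

/-- The `Z` component is polynomial time. [folklore] -/
theorem zF_mem_FP : g1F (zG P) ∈ FP := by
  have hy := hygiene P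
  exact g1F_mem_FP _ (hy _ (by simp)).1 (hy _ (by simp)).2.2

/-- `pieceF ∈ FP`. [folklore] -/
theorem pieceF_mem_FP : pieceF P ∈ FP := by
  obtain ⟨ha, hb, hc, hd⟩ := g2F_parts_mem_FP P
  have hz : zOfF ∈ FP := comp_mem_FP fstF_mem_FP fstF_mem_FP
  have hB : BFz P ∈ FP := comp_mem_FP (blk_desc_mem_FP P) hz
  have hZ : ZFz P ∈ FP := comp_mem_FP (zF_mem_FP P) hz
  have ha' : GaF P ∈ FP := comp_mem_FP ha fmt2_mem_FP
  have hb' : GbF P ∈ FP := comp_mem_FP hb fmt2_mem_FP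
  have hc' : GcF P ∈ FP := comp_mem_FP hc fmt2_mem_FP
  have hd' : GdF P ∈ FP := comp_mem_FP hd fmt2_mem_FP
  have h := append_mem_FP ha' (append_mem_FP hB (append_mem_FP hZ (append_mem_FP hB (append_mem_FP hb' (append_mem_FP hB
    (append_mem_FP hZ (append_mem_FP hB (append_mem_FP hc' (append_mem_FP hB (append_mem_FP hZ (append_mem_FP hB hd')))))))))))
  exact h

/-- The bits of a phase macro. [folklore] -/
theorem flatMap_bits_pMacro (u j c : ℕ) :
    (pMacro P u j c).flatMap RtOp.bits =
      (openOps P u j c).flatMap opBits ++ (blkC P u).flatMap opBits ++ (zOps (eW P u 0)).flatMap RtOp.bits ++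
        ((blkC P u).flatMap opBits ++ (closeOps P u j c).flatMap opBits) := by
  rw [pMacro, (pOpen_eq P u j c).1, (pOpen_eq P u j c).2]
  simp only [List.flatMap_append, flatMap_bits_map_cl, List.map_append, List.append_assoc]

/-- **`pieceF` computes the description of Hadamard layer `j` and the phase macros of layer `j + 1`.**
[folklore] -/
theorem pieceF_apply (z r : List Bool) (j : ℕ) :
    pieceF P (boolPair (boolPair z r) (ones j)) = (hLayer P z.length j ++ pLayer P z.length (j + 1)).flatMap RtOp.bits := by
  obtain ⟨ea, eb, ec, ed⟩ := out_GG P z.length j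
  have hZ : g1F (zG P) z = (zOps (eW P z.length 0)).flatMap RtOp.bits := by
    rw [g1F, out_zG, render_rtoks_nil]; simp [envU]
  simp only [pieceF, GaF, GbF, GcF, GdF, BFz, ZFz, Function.comp_apply]
  rw [fmt2_apply, zOfF_apply, g2F_fmt, g2F_fmt, g2F_fmt, g2F_fmt, ea, eb, ec, ed, hZ, render_rtoks_opToks,
    pLayer, List.flatMap_append, List.flatMap_append, List.flatMap_append,
    flatMap_bits_pMacro, flatMap_bits_pMacro, flatMap_bits_pMacro]
  have er : ∀ a b : List (ClOp ℕ), Tok.render 0 (a.flatMap opToks ++ b.flatMap opToks) = a.flatMap opBits ++ b.flatMap opBits := by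
    intro a b; rw [← List.flatMap_append, render_flatMap_opToks_nil, List.flatMap_append]
  simp only [er, render_flatMap_opToks_nil]
  simp only [List.append_assoc]

end FPParts

/-! ### Folding the layer pieces -/

section Fold

variable (pa pb pc pd pB pZ : Polynomial ℕ)

/-- `Ly(N)` as a polynomial. [folklore] -/
def LyPoly : Polynomial ℕ := X + C P.cL

/-- Value of `LyPoly`. [folklore] -/
@[simp] theorem eval_LyPoly (n : ℕ) : (LyPoly P).eval n = Ly P n := by simp [LyPoly, Ly]

/-- The ruler polynomial: room for the rounds and for every piece (the bounds `pa, …, pd` of the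
two-input parts at argument length `2N + cL + 1`, `pB` of the block, `pZ` of the `Z` gadget). [folklore] -/
def rulerPoly : Polynomial ℕ :=
  LyPoly P + C 1 + ((pa + pb + pc + pd).comp (C 2 * X + C (P.cL + 1)) + C 6 * pB + C 3 * pZ)

/-- The initial record of the fold: `⟨⟨z, ruler⟩, ⟨bin Ly, ⟨1⁰, []⟩⟩⟩`. [folklore] -/
def initL : List Bool → List Bool :=
  fanoutFn (fanoutFn (fun z => z) (polyFn (rulerPoly P pa pb pc pd pB pZ)))
    (fanoutFn (lenBinF ∘ polyFn (LyPoly P)) (fun _ => boolPair [] []))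

/-- **The description of all layers** as a string function: fold the pieces `j < Ly`.
[cite: AroraBarak2009, §1.3 (bounded loops)] -/
def layersF : List Bool → List Bool := sndPow 2 ∘ foldLoop appF (clipF 1 (pieceF P)) X ∘ initL P pa pb pc pd pB pZ

/-- `layersF ∈ FP`. [folklore] -/
theorem layersF_mem_FP : layersF P pa pb pc pd pB pZ ∈ FP :=
  comp_mem_FP (sndPow_mem_FP 2) (comp_mem_FP (foldLoop_clipF_mem_FP 1 appF_mem_FP length_appF_le (pieceF_mem_FP P) X)
    (fanoutFn_mem_FP (fanoutFn_mem_FP (PolyTimeComputable.id _) (polyFn_mem_FP _))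
      (fanoutFn_mem_FP (comp_mem_FP lenBinF_mem_FP (polyFn_mem_FP _)) (const_mem_FP _))))

/-- **The fold computes the description of the layer loop**, provided the parts are bounded by the
polynomials of the ruler. [folklore] -/
theorem layersF_apply (hpa : ∀ v, (g2F (GaG P) v).length ≤ pa.eval v.length) (hpb : ∀ v, (g2F (GbG P) v).length ≤ pb.eval v.length)
    (hpc : ∀ v, (g2F (GcG P) v).length ≤ pc.eval v.length) (hpd : ∀ v, (g2F (GdG P) v).length ≤ pd.eval v.length)
    (hpB : ∀ z : List Bool, ((blkC P z.length).flatMap opBits).length ≤ pB.eval z.length)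
    (hpZ : ∀ z : List Bool, (g1F (zG P) z).length ≤ pZ.eval z.length) (z : List Bool) :
    layersF P pa pb pc pd pB pZ z = (layers P z.length).flatMap RtOp.bits := by
  set n := z.length with hn
  set ctx := boolPair z (ones ((rulerPoly P pa pb pc pd pB pZ).eval n)) with hctx
  have hinit : initL P pa pb pc pd pB pZ z = boolPair ctx (boolPair (encodeNat (Ly P n)) (boolPair (ones 0) [])) := by
    simp [initL, fanoutFn_apply, hctx, hn, ones]
  have hrounds : Ly P n ≤ (X : Polynomial ℕ).eval ctx.length := by
    rw [eval_X, hctx, length_boolPair]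
    have : Ly P n ≤ (rulerPoly P pa pb pc pd pB pZ).eval n := by simp [rulerPoly]; omega
    simp [ones]; omega
  -- the pieces are within the ruler
  have hpiece : ∀ j, 0 ≤ j → j < 0 + Ly P n →
      (pieceF P (boolPair ctx (ones j))).length ≤ 1 * (ctx.length + 1) := by
    intro j _ hj
    have hjL : j < Ly P n := by omega
    have hfmt : (List.replicate n true ++ false :: ones j).length ≤ 2 * n + (P.cL + 1) := by
      simp [ones]; unfold Ly at hjL; omega
    have hx : ∀ {g : List Bool → List Bool} {q : Polynomial ℕ}, (∀ v, (g v).length ≤ q.eval v.length) →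
        (g (fmt2 (boolPair ctx (ones j)))).length ≤ q.eval (2 * n + (P.cL + 1)) := fun {g q} hg => by
      rw [hctx, fmt2_apply, ← hn]
      exact (hg _).trans (TM2Iter.eval_mono q hfmt)
    have hB : (BFz P (boolPair ctx (ones j))).length ≤ pB.eval n := by
      rw [BFz, Function.comp_apply, hctx, zOfF_apply, ← hn]; exact hpB z
    have hZ : (ZFz P (boolPair ctx (ones j))).length ≤ pZ.eval n := by
      rw [ZFz, Function.comp_apply, hctx, zOfF_apply]; have := hpZ z; rw [← hn] at this; exact this
    have ha := hx (g := g2F (GaG P)) hpa; have hb := hx (g := g2F (GbG P)) hpb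
    have hc := hx (g := g2F (GcG P)) hpc; have hd := hx (g := g2F (GdG P)) hpd
    have hr : (rulerPoly P pa pb pc pd pB pZ).eval n = Ly P n + 1 +
        ((pa + pb + pc + pd).eval (2 * n + (P.cL + 1)) + 6 * pB.eval n + 3 * pZ.eval n) := by
      simp [rulerPoly]
    have hcl : ctx.length = 2 * n + 2 + (rulerPoly P pa pb pc pd pB pZ).eval n := by
      rw [hctx, length_boolPair, ← hn]; simp
    rw [pieceF]
    simp only [List.length_append, GaF, GbF, GcF, GdF, Function.comp_apply, one_mul, hcl]
    simp only [eval_add] at hr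
    omega
  rw [layersF, Function.comp_apply, Function.comp_apply, hinit, foldLoop_apply appF (clipF 1 (pieceF P)) hrounds 0 [],
    sndPow_succ_boolPair, sndPow_succ_boolPair, sndPow_zero_boolPair, foldAcc_clipF hpiece, foldAcc_appF, List.nil_append,
    layers, List.flatMap_assoc, CWrap.flatMap_range_eq_ccat]
  refine ccat_congr fun j hj => ?_
  rw [Nat.zero_add, hctx, pieceF_apply P z _ j, ← hn]

end Fold

/-! ### The assembly -/

section Assembly

/-- `D(N)` as a polynomial. [folklore] -/
def DPoly : Polynomial ℕ := X + C 3 * (X + C P.cW) + (X + C P.cL) + C 4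
/-- `nT(N)` as a polynomial. [folklore] -/
def nTPoly : Polynomial ℕ := DPoly P + C 2 * X + C 2
/-- `TWv(N)` as a polynomial. [folklore] -/
def TWvPoly : Polynomial ℕ := (RevClean.widthPoly P.e P.M).comp (nTPoly P) + (X + C P.cW) + (X + C P.cL) + C 3

/-- Value of `nTPoly`. [folklore] -/
@[simp] theorem eval_nTPoly (n : ℕ) : (nTPoly P).eval n = nT P n := by
  simp [nTPoly, DPoly, nT, D, Wq, Ly]; ring

/-- Value of `TWvPoly`. [folklore] -/
@[simp] theorem eval_TWvPoly (n : ℕ) : (TWvPoly P).eval n = TWv P n := by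
  simp only [TWvPoly, eval_add, eval_comp, eval_nTPoly, RevClean.eval_widthPoly, eval_X, eval_C, TWv, Wblk, Wq, Ly]

/-- The ancilla count in unary: `1^{TWv N}` with the first `N` symbols dropped. [folklore] -/
def ancF : List Bool → List Bool := dropFn ∘ fanoutFn (fun z => z) (polyFn (TWvPoly P))

/-- Value of `ancF`. [folklore] -/
theorem ancF_apply (z : List Bool) : ancF P z = unaryEncodeNat (anc P z.length) := by
  simp only [ancF, Function.comp_apply, fanoutFn_apply, dropFn_boolPair, polyFn_apply, eval_TWvPoly, ones, List.drop_replicate, anc]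
  exact (RevDesc.unaryEncodeNat_eq_replicate _).symm

/-- `ancF ∈ FP`. [folklore] -/
theorem ancF_mem_FP : ancF P ∈ FP := comp_mem_FP dropFn_mem_FP (fanoutFn_mem_FP (PolyTimeComputable.id _) (polyFn_mem_FP _))

/-- **The description of the circuit is the concatenation of the `RtOp.bits` of `allOps`.** [folklore] -/
theorem encode_bigCirc (N : ℕ) : QCircuit.encode (bigCirc P N) = (allOps P N).flatMap RtOp.bits := by
  unfold bigCirc
  rw [RevDesc.encode_eq_flatMap]
  exact flatMap_gateEnc_compileList (TW_pos P N) (allOps P N) (allOps_lt P N) _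

/-- **The phase-query family is polynomial-time uniform.**
[cite: AroraBarak2009, §6.2 Def. 6.12 and Remark 6.7 (descriptions printed in polynomial time)] -/
theorem family_isUniform : (family P).IsUniform := by
  obtain ⟨pa, hpa⟩ := exists_poly_length_le_of_mem_FP (g2F_parts_mem_FP P).1
  obtain ⟨pb, hpb⟩ := exists_poly_length_le_of_mem_FP (g2F_parts_mem_FP P).2.1
  obtain ⟨pc, hpc⟩ := exists_poly_length_le_of_mem_FP (g2F_parts_mem_FP P).2.2.1
  obtain ⟨pd, hpd⟩ := exists_poly_length_le_of_mem_FP (g2F_parts_mem_FP P).2.2.2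
  obtain ⟨pB, hpB⟩ := exists_poly_length_le_of_mem_FP (blk_desc_mem_FP P)
  obtain ⟨pZ, hpZ⟩ := exists_poly_length_le_of_mem_FP (zF_mem_FP P)
  refine QCircuitFamily.isUniform_of_descFn_mem_FP ?_
  have h := fanoutFn_mem_FP lenBinF_mem_FP (fanoutFn_mem_FP (ancF_mem_FP P)
    (append_mem_FP (preF_mem_FP P) (append_mem_FP (layersF_mem_FP P pa pb pc pd pB pZ) (finF_mem_FP P))))
  have e : (family P).descFn = fanoutFn lenBinF (fanoutFn (ancF P)
      (fun z => preF P z ++ (layersF P pa pb pc pd pB pZ z ++ finF P z))) := by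
    funext z
    rw [fanoutFn_apply, fanoutFn_apply, lenBinF_apply, ancF_apply, QCircuitFamily.descFn_eq, preF_apply,
      layersF_apply P pa pb pc pd pB pZ hpa hpb hpc hpd hpB hpZ, finF_apply]
    change boolPair _ (boolPair _ (QCircuit.encode (bigCirc P z.length))) = _
    rw [encode_bigCirc, allOps]
    simp only [List.flatMap_append, List.append_assoc]
    rfl
  rw [e]
  exact h

end Assembly

end PhaseQuery

end Literature.Computability.QuantumComplexity
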